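import Summits.AtomisticToContinuum.HydrodynamicLimit.Theorems.JParityClosureEvenStressEnskogMicroStationarityBounds
import Summits.AtomisticToContinuum.HydrodynamicLimit.Theorems.JParityClosureEvenStressEnskogKineticEnergyTight
import Summits.AtomisticToContinuum.HydrodynamicLimit.Theorems.EvenStressEnskog.Negative.FrequencyLawReduction
import Literature.MathematicalPhysics.KineticTheory.HardSphereEulerProofs
import Literature.MathematicalPhysics.KineticTheory.HardSphereCanonicalTorus
import HarnessLib

/-!
# Microscale stationarity, II: `stub_microStationarity_of` (stub S2 of the line
# `stationary-microscale-hierarchy-entrance-law` of the crux `JParityClosure.EvenStressEnskog`,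
# stmt-AtomisticToContinuum-13079)

**FREEZE, tested — MICROSCALE STATIONARITY from the cluster transport identity.**  Along a good
orbit of `N + 1` hard spheres of diameter `ε = hsDiameter σ N` on `𝕋³` the cluster transport
identity (hypothesis `hT`, the landed S1 `stub_clusterTransport`) reads
`streamStat + collJump = ε (I(τ) − I(0)) − ε · wRateStat`.  The right-hand side is bounded SURELY
on the energy shell `(N+1)⁻¹ E(z) ≤ K` by `ε · C(K)` (`abs_streamStat_add_collJump_le`, file I),
with `C(K)` independent of `N` (packing bound on the window observable, sup bounds of `χ, ∂ₛχ` on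
the compact `[0, τ] × 𝕋³`, global bounds of `g, g'`, compact support of `P`).  The kinetic energy
per particle is tight under the local Gibbs law uniformly in `N` (`stub_kineticEnergyTight`), the
bad set of the flow is null (`localGibbsLaw_compl_good`), and `ε = hsDiameter σ N → 0`
(`tendsto_hsDiameter`), so for `N ≥ N₀` the event `{η < |streamStat + collJump|}` is contained in
the union of the null bad set and the energy tail event of probability `≤ δ`.  No measurability of
the functionals is needed (outer-measure monotonicity).

References: H. Spohn, *Large Scale Dynamics of Interacting Particles* (1991), Part I §3.2 (the
`O(ε)` terms of the weak balance laws). Elementary. [folklore]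
-/

noncomputable section

open MeasureTheory Set Filter Function Metric
open scoped BigOperators Topology InnerProductSpace ENNReal

namespace Summit.AtomisticToContinuum.HydrodynamicLimit.Theorems.EvenStressEnskog

open Literature.Analysis.FluidPDE Literature.Analysis.FunctionSpaces
  Literature.MathematicalPhysics.KineticTheory
  Literature.MathematicalPhysics.KineticTheory.StationaryMicroscale

/-- A continuous function on `ℝ × 𝕋³` is bounded on the compact slab `[0, τ] × 𝕋³`. [folklore] -/
theorem exists_bound_on_slab_torus3 {F : ℝ × T3 → ℝ} (hF : Continuous F) (τ : ℝ) :
    ∃ C : ℝ, ∀ s ∈ Icc (0 : ℝ) τ, ∀ x : T3, |F (s, x)| ≤ C := by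
  obtain ⟨B, hB⟩ := (isCompact_Icc.prod isCompact_univ).exists_bound_of_continuousOn
    (s := Icc (0 : ℝ) τ ×ˢ (univ : Set T3)) hF.continuousOn
  refine ⟨B, fun s hs x => ?_⟩
  have h := hB (s, x) ⟨hs, mem_univ _⟩
  rwa [Real.norm_eq_abs] at h

/-- **S2 · MICROSCALE STATIONARITY from FREEZE** (registered stub `stub_microStationarity_of` of
the line `stationary-microscale-hierarchy-entrance-law`, `ClusterTransportIdentity →
MicroStationarity` with the hypothesis spelled out).  Along the flow from local Gibbs data, for
`χ` continuous with continuous `s`-derivative, `g ∈ C¹` bounded with bounded derivative, every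
level `m`, every compactly supported `C¹` tuple test function `P`, every fixed `r ∈ (0, 1/2)`:
`P_LG(η < |streamStat + collJump|) ≤ δ` for `N ≥ N₀`.  Proof: the sure bound
`|streamStat + collJump| ≤ ε C(K)` on good orbits of energy per particle `≤ K`
(`abs_streamStat_add_collJump_le` and the identity `hT`, whose support hypothesis holds for large
`N` since `tsupport P` has bounded positions and `ε → 0`), tightness of the energy per particle
(`stub_kineticEnergyTight`), nullity of the bad set (`localGibbsLaw_compl_good`), `ε → 0`
(`tendsto_hsDiameter`). [folklore] -/
theorem stub_microStationarity_of
    (hT : ∀ (σ : ℝ) (N : ℕ), 0 < σ → ∀ Φ : HardSphereFlow (Torus.geometry (Fin 3)) (hsDiameter σ N) (N + 1), ∀ z ∈ Φ.good,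
      ∀ τ : ℝ, 0 < τ → ∀ χ : ℝ × T3 → ℝ, Continuous χ → (∀ x₀, Differentiable ℝ fun s => χ (s, x₀)) →
      Continuous (fun p : ℝ × T3 => deriv (fun s => χ (s, p.2)) p.1) →
      ∀ g : ℝ → ℝ, ContDiff ℝ 1 g → ∀ r : ℝ, 0 < r → r < 1 / 2 →
      ∀ (m : ℕ) (P : (Fin m → V3 × V3) → ℝ), ContDiff ℝ 1 P → HasCompactSupport P →
      (∀ q ∈ tsupport P, ∀ a, hsDiameter σ N * ‖(q a).1‖ < 1 / 2) →
        hsDiameter σ N * (winInt σ N Φ χ g r P τ z - winInt σ N Φ χ g r P 0 z)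
          - hsDiameter σ N * wRateStat σ N Φ τ χ g r P z - streamStat σ N Φ τ χ g r P z
          = collJump σ N Φ τ χ g r P z) :
  ∀ (a₀ θ₀ : T3 → ℝ) (u₀ : T3 → V3), Continuous a₀ → Continuous θ₀ → Continuous u₀ →
    (∀ x, 0 < a₀ x) → (∀ x, 0 < θ₀ x) → ∃ σ₀ : ℝ, 0 < σ₀ ∧ ∀ σ : ℝ, 0 < σ → σ < σ₀ →
    ∀ Φ : (N : ℕ) → HardSphereFlow (Torus.geometry (Fin 3)) (hsDiameter σ N) (N + 1), ∀ τ : ℝ, 0 < τ →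
    ∀ χ : ℝ × T3 → ℝ, Continuous χ → (∀ x₀, Differentiable ℝ fun s => χ (s, x₀)) →
    Continuous (fun p : ℝ × T3 => deriv (fun s => χ (s, p.2)) p.1) →
    ∀ g : ℝ → ℝ, ContDiff ℝ 1 g → (∃ C : ℝ, ∀ a, |g a| ≤ C) → (∃ C : ℝ, ∀ a, |deriv g a| ≤ C) →
    ∀ (m : ℕ) (P : (Fin m → V3 × V3) → ℝ), ContDiff ℝ 1 P → HasCompactSupport P →
    ∀ r : ℝ, 0 < r → r < 1 / 2 → ∀ η δ : ℝ, 0 < η → 0 < δ → ∃ N₀ : ℕ, ∀ N : ℕ, N₀ ≤ N →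
      localGibbsLaw σ a₀ u₀ θ₀ N (Φ N)
        {z | η < |streamStat σ N (Φ N) τ χ g r P z + collJump σ N (Φ N) τ χ g r P z|} ≤ ENNReal.ofReal δ := by
  intro a₀ θ₀ u₀ ha hθ hu ha0 hθ0
  obtain ⟨σ₁, hσ₁, HK⟩ := stub_kineticEnergyTight a₀ θ₀ u₀ ha hθ hu ha0 hθ0
  refine ⟨σ₁, hσ₁, ?_⟩
  intro σ hσ hσlt Φ τ hτ χ hχ hχd hχ' g hg hgB hgB' m P hP hPc r hr hr2 η δ hη hδ
  obtain ⟨Mg, hMg⟩ := hgB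
  obtain ⟨Mg', hMg'⟩ := hgB'
  -- (a) sup bounds of `χ` and `∂ₛχ` on the compact slab `[0, τ] × 𝕋³`, of `P`, and the support radius
  obtain ⟨Mχ, hMχ⟩ := exists_bound_on_slab_torus3 hχ τ
  obtain ⟨Mχ', hMχ'⟩ : ∃ C : ℝ, ∀ s ∈ Icc (0 : ℝ) τ, ∀ x : T3,
      |deriv (fun s' => χ (s', x)) s| ≤ C := exists_bound_on_slab_torus3 hχ' τ
  obtain ⟨MP, hMP⟩ : ∃ C : ℝ, ∀ q, |P q| ≤ C := by
    obtain ⟨C, hC⟩ := hP.continuous.bounded_above_of_compact_support hPc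
    exact ⟨C, fun q => by simpa only [Real.norm_eq_abs] using hC q⟩
  obtain ⟨R, hR0, hR⟩ := exists_radius_of_hasCompactSupport hPc
  -- (b) tightness of the kinetic energy per particle
  obtain ⟨K, N₁, hK⟩ := HK σ hσ hσlt Φ δ hδ
  -- the sure constant `C(K)` of file I
  set CW : ℝ := ((2 * R + 1) ^ 3) ^ m * MP
  set C : ℝ := 2 * (Mχ * Mg * CW) +
    τ * ((Mχ' * Mg + Mχ * Mg' * (σ ^ 3 * (3 / (Real.pi * r ^ 4) * (1 / 2 + K)))) * CW)
  -- (c) `ε R < 1/2` and `ε C(K) < η` for large `N`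
  have hev : ∀ᶠ N : ℕ in atTop, hsDiameter σ N * R < 1 / 2 ∧ hsDiameter σ N * C < η := by
    have h1 : Tendsto (fun N : ℕ => hsDiameter σ N * R) atTop (𝓝 0) := by
      simpa using (tendsto_hsDiameter σ).mul_const R
    have h2 : Tendsto (fun N : ℕ => hsDiameter σ N * C) atTop (𝓝 0) := by
      simpa using (tendsto_hsDiameter σ).mul_const C
    filter_upwards [h1.eventually_lt_const (show (0 : ℝ) < 1 / 2 by norm_num),
      h2.eventually_lt_const hη] with N hN1 hN2
    exact ⟨hN1, hN2⟩
  obtain ⟨N₂, hN₂⟩ := Filter.eventually_atTop.1 hev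
  refine ⟨max N₁ N₂, fun N hN => ?_⟩
  have hN1 : N₁ ≤ N := le_of_max_le_left hN
  obtain ⟨hNR, hNC⟩ := hN₂ N (le_of_max_le_right hN)
  have hε : 0 < hsDiameter σ N := hsDiameter_pos hσ N
  -- (d) the deviation event lies in the bad set plus the energy tail event
  have hsub : {z | η < |streamStat σ N (Φ N) τ χ g r P z + collJump σ N (Φ N) τ χ g r P z|} ⊆
      (Φ N).goodᶜ ∪ {z | K < ((N : ℝ) + 1)⁻¹ * configEnergy ((Φ N).flow 0 z)} := by
    intro z hz
    by_contra hcon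
    simp only [mem_union, mem_compl_iff, mem_setOf_eq, not_or, not_not, not_lt] at hcon
    obtain ⟨hzg, hzE⟩ := hcon
    rw [(Φ N).flow_zero z hzg] at hzE
    have hW : ∀ w ∈ hardSphereDomain (Torus.geometry (Fin 3)) (N + 1) (hsDiameter σ N), ∀ x₀,
        |winObs (hsDiameter σ N) P w x₀| ≤ CW := fun w hw x₀ =>
      abs_winObs_le_of_mem_hardSphereDomain hε hMP hR0 hR hw x₀
    have hsupp : ∀ q ∈ tsupport P, ∀ a, hsDiameter σ N * ‖(q a).1‖ < 1 / 2 := fun q hq a =>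
      (mul_le_mul_of_nonneg_left (hR q hq a) hε.le).trans_lt hNR
    have hid := hT σ N hσ (Φ N) z hzg τ hτ χ hχ hχd hχ' g hg r hr hr2 m P hP hPc hsupp
    have hb := abs_streamStat_add_collJump_le hσ (Φ N) hτ.le hr hMχ hMχ' hMg hMg' hW hzg hzE hid
    exact (lt_irrefl η) ((hz.trans_le hb).trans hNC)
  calc localGibbsLaw σ a₀ u₀ θ₀ N (Φ N)
        {z | η < |streamStat σ N (Φ N) τ χ g r P z + collJump σ N (Φ N) τ χ g r P z|}
      ≤ localGibbsLaw σ a₀ u₀ θ₀ N (Φ N)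
          ((Φ N).goodᶜ ∪ {z | K < ((N : ℝ) + 1)⁻¹ * configEnergy ((Φ N).flow 0 z)}) :=
        measure_mono hsub
    _ ≤ localGibbsLaw σ a₀ u₀ θ₀ N (Φ N) (Φ N).goodᶜ +
          localGibbsLaw σ a₀ u₀ θ₀ N (Φ N) {z | K < ((N : ℝ) + 1)⁻¹ * configEnergy ((Φ N).flow 0 z)} :=
        measure_union_le _ _
    _ ≤ ENNReal.ofReal δ := by
        rw [localGibbsLaw_compl_good (Φ N), zero_add]
        exact hK N hN1 0

end Summit.AtomisticToContinuum.HydrodynamicLimit.Theorems.EvenStressEnskog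

end
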